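import Summits.QuantumFields.YangMills.Theorems.BalabanUVNodesN07FaceDatumGeometry
import Literature.MathematicalPhysics.QuantumFieldTheory.Balaban1983to89.Node00.CriticalOnFibreTop
import Literature.MathematicalPhysics.QuantumFieldTheory.Balaban1983to89.Node00.Record12BgRowCoClassCPM
import Literature.MathematicalPhysics.QuantumFieldTheory.Balaban1983to89.B10Eq2DensityTower
import Literature.MathematicalPhysics.QuantumFieldTheory.Balaban1983to89.B16Thm1BaseAtRecord11

/-!
# BalabanUVNodes ∕ N07 ([Balaban1985Variational] Thm 1 (6)–(8) ∕ Prop. 8 p. 304, TOP-DOMAIN ∕ `CoP` currency of director-ym №160's F7 edition) —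
# def-P11's GUARDED top-domain facts `VariationalThm1RegSepTop7M F N Sup B₃ a₀ a₁` and `VariationalThm1RegSepCoP7M` (FILE 12d; binder `0 < M₁`,
# LOCATED-P11-EMPTY-SUPPORT) FROM THE TOP-DOMAIN STEP FORM OF PROPOSITION 8 (`Node00.Prop8RegSepTopStep`), the step `k = 0` being the FLAT unconstrained minimiser

Cell `pub-ymgap`, seat `pub-ymgap-dag-n07-e` generation 8 (R141 (C), DAG node N07 = [15]; ROW P11; INBOX INTENT-20d ∕ AMEND-20d).  `--kind proof --supports stmt-QuantumFields-20293 --as helper`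
(plan g68 KEY-20).  THEOREMS ONLY (0 `def`, 0 `sorry`).  Twin of `…N07Thm1Co7FromProp8` (p521373) with FILE 12a's top-domain objects (`Sect2.omegaPlaqsTop ∕ omegaBondsTop ∕
CoDivClassOnTop`) and FILE 12d's binder `0 < ν.M₁` (node00-def-P11 g3 LOCATED-P11-EMPTY-SUPPORT: at `M₁ = 0` the support selector of record is empty).

WHAT THIS FILE DOES.  At `k = 0` the determining set is empty (`B16Thm1BaseAtRecord11.agreeOn_genSet_seq_zero`, cited), so a (2.12) minimiser over print's class (6)
ON ANY TOP DOMAIN `Ω₀` is an unconstrained minimiser in a class containing `1`: action `0`, every plaquette trivial, zero co-divergence ⇒ (8) with room (`0 < B₃δ_n`).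
Hence ★ `variationalThm1RegSepTop7M_of_prop8TopStep (Sup) (hB : 0 < B₃)` and ★ `variationalThm1RegSepCoP7M_of_prop8TopStep (hB)` (FILE 12d: `…CoP7M` IS `…Top7M`
at `Sup := suppDomOfRecord`, definitional) — the K0 row's displayed [15] content under `CoP` (guarded) ⟸ [15] PROP. 8 (top-domain step form) + Fermat, for `0 < B₃`.

HONEST FRAMING: count-neutral kernel bookkeeping; Prop. 8 NOT claimed; nothing of Bałaban asserted; N07 ∕ K0⁗ NOT discharged (5∕27); one finite T⁴ programme at
fixed ε — NOT continuum ∕ ℝ⁴ ∕ OS ∕ mass gap ∕ Clay.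

DEPENDENCES (by name): `Node00.(Prop8RegSepTopStep, regular_of_isMinimizer_classTop_of_prop8TopStep)` (this seat, `CriticalOnFibreTop` p524052), def-P11 FILE 12d
`Node00.(VariationalThm1RegSepTop7M, VariationalThm1RegSepCoP7M, VariationalThm1RegSepTop7M.toCoP7M)`, def-R FILE 22′ `Node00.suppDomOfRecord`, part A1 `norm_coDivSum_le`,
19a `dist1_plaqHol_sq_le_wilsonAction4`, `B10Eq2DensityTower.wilsonAction4_one`, `B16Thm1BaseAtRecord11.agreeOn_genSet_seq_zero`.
-/

noncomputable section

namespace Summit.QuantumFields.YangMills.BalabanUVNodes.N07Thm1Top7FromProp8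

open Literature.MathematicalPhysics.QuantumFieldTheory.Balaban1983to89
open Literature.MathematicalPhysics.QuantumFieldTheory.Balaban1983to89.T4Continuum (T4Family)
open Literature.MathematicalPhysics.QuantumFieldTheory.Balaban1983to89.Node00
open Literature.MathematicalPhysics.QuantumFieldTheory.Balaban1983to89.B15DeterminingSets
open Summit.QuantumFields.YangMills.BalabanUVNodes.N07SmallActionBoundaryAvoidance (dist1_plaqHol_sq_le_wilsonAction4)
open Summit.QuantumFields.YangMills.BalabanUVNodes.N07FaceDatumAverage (norm_coDivSum_le)
open scoped Matrix.Norms.L2Operator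

variable {F : T4Family} {N : ℕ} [NeZero N]

/-- **AT `k = 0` A MINIMISER OVER PRINT'S CLASS (6) ON A TOP DOMAIN IS FLAT**: the class contains `1` (`ε₀ > 0`), the fibre is everything (empty determining set),
so `A(U₀) ≤ A(1) = 0` and every plaquette of `U₀` has `dist1 = 0`. [cite: Balaban1985Variational, (5)–(6) p.278; Balaban1985RegularSpaces, (1.10) p.77] -/
theorem dist1_plaqHol_eq_zero_of_isMinimizer_classTop_zero {ν : Stage7Numerics} {M : ℕ} {g : ℕ → ℝ} {K : ℕ} (s : SeqOfRecord F ν M g K 0)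
    {Ω₀ : Set (Site (F.P K) 0)} {ε₀ : ℝ} (hε₀ : 0 < ε₀) {W : MSField (F.P K) (SU N)} {U₀ : GaugeField (F.P K) 0 (SU N)}
    (hU₀ : IsMinimizer (avOfRecord F N K)
      {U | (∀ n, n ≤ 0 → PlaqSmallOn (Sect2.omegaPlaqsTop s.Ω Ω₀ n) (ε₀ * (F.P K).eta n ^ 2) U) ∧ Sect2.CoDivClassOnTop s.Ω Ω₀ 0 ε₀ U}
      (genSet s.Ω 0) W U₀)
    (q : Plaq (F.P K) 0) : dist1 (GaugeField.plaqHol U₀ q) = 0 := by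
  have hη : ∀ n, 0 < (F.P K).eta n := fun n => pow_pos (inv_pos.mpr (by exact_mod_cast (F.P K).L_pos)) n
  have h1plaq : ∀ q : Plaq (F.P K) 0, dist1 (GaugeField.plaqHol (1 : GaugeField (F.P K) 0 (SU N)) q) ≤ 0 := fun q => by
    show dist1 ((1 : SU N) * 1 * 1⁻¹ * 1⁻¹) ≤ 0
    rw [inv_one, mul_one, mul_one, mul_one, GaugeGroup.dist1_one]
  have h1 : (1 : GaugeField (F.P K) 0 (SU N)) ∈
      {U | (∀ n, n ≤ 0 → PlaqSmallOn (Sect2.omegaPlaqsTop s.Ω Ω₀ n) (ε₀ * (F.P K).eta n ^ 2) U) ∧ Sect2.CoDivClassOnTop s.Ω Ω₀ 0 ε₀ U} := by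
    refine ⟨fun n _ q _ => (h1plaq q).trans_lt (mul_pos hε₀ (pow_pos (hη n) 2)), fun j _ b _ => ?_⟩
    have h := norm_coDivSum_le (1 : GaugeField (F.P K) 0 (SU N)) le_rfl h1plaq b.src b.dir
    rw [mul_zero, mul_zero] at h
    exact h.trans_lt (mul_pos hε₀ (pow_pos (hη j) 3))
  have hA : wilsonAction4 U₀ ≤ 0 := by
    have h := hU₀.2.2 1 h1 (B16Thm1BaseAtRecord11.agreeOn_genSet_seq_zero F N s _ _)
    have h0 : wilsonAction4 (1 : GaugeField (F.P K) 0 (SU N)) = 0 := B10Eq2DensityTower.wilsonAction4_one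
    linarith
  have hsq := dist1_plaqHol_sq_le_wilsonAction4 U₀ q
  have hN : (0 : ℝ) ≤ 2 * N := by positivity
  have h2 : 2 * (N : ℝ) * wilsonAction4 U₀ ≤ 0 := mul_nonpos_of_nonneg_of_nonpos hN hA
  have h3 : dist1 (GaugeField.plaqHol U₀ q) ^ 2 = 0 := le_antisymm (hsq.trans h2) (sq_nonneg _)
  exact pow_eq_zero_iff (two_ne_zero) |>.mp h3

/-- ★ **DEF-P11's GUARDED TOP-DOMAIN FACT (FILE 12d, binder `0 < M₁`) FROM THE TOP-DOMAIN STEP FORM OF PROPOSITION 8**, for `0 < B₃` and ANY support selector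
`Sup`: at a genuine step by `regular_of_isMinimizer_classTop_of_prop8TopStep` (minimal over the open class ⇒ critical ⇒ Prop. 8), at `k = 0` by flatness of the
unconstrained minimiser. [cite: Balaban1985Variational, Thm 1 (6)–(8) pp.278–279, p.299, Prop. 8 p.304; Balaban1988Convergent, (2.12) p.256] -/
theorem variationalThm1RegSepTop7M_of_prop8TopStep (Sup : (ν : Stage7Numerics) → (K : ℕ) → (ℕ → Set (Site (F.P K) 0)) → Set (Site (F.P K) 0))
    {B₃ a₀ a₁ : ℝ} (hB : 0 < B₃) (h8 : Prop8RegSepTopStep F N Sup B₃ a₀ a₁) :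
    VariationalThm1RegSepTop7M F N Sup B₃ a₀ a₁ := by
  intro ν M g K k s hsep hM₁ ε₀ δ hδ hcomp hcomp' hε₀ W h7 U₀ hU₀
  rcases Nat.eq_zero_or_pos k with rfl | hk
  · -- `k = 0`: the unconstrained minimiser is flat
    have hε₀pos : 0 < ε₀ := lt_of_lt_of_le (mul_pos hB (hδ 0 le_rfl).1) (hδ 0 le_rfl).2.2
    have hη : ∀ n, 0 < (F.P K).eta n := fun n => pow_pos (inv_pos.mpr (by exact_mod_cast (F.P K).L_pos)) n
    have hflat : ∀ q, dist1 (GaugeField.plaqHol U₀ q) ≤ 0 := fun q =>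
      le_of_eq (dist1_plaqHol_eq_zero_of_isMinimizer_classTop_zero s hε₀pos hU₀ q)
    refine ⟨fun n hn q _ => (hflat q).trans_lt (mul_pos (mul_pos hB (hδ n hn).1) (pow_pos (hη n) 2)), fun n hn b _ => ?_⟩
    have h := norm_coDivSum_le U₀ le_rfl hflat b.src b.dir
    rw [mul_zero, mul_zero] at h
    exact h.trans_lt (mul_pos (mul_pos hB (hδ n hn).1) (pow_pos (hη n) 3))
  · exact regular_of_isMinimizer_classTop_of_prop8TopStep h8 ν M g K k s hsep hM₁ hk ε₀ δ hδ hcomp hcomp' hε₀ W h7 hU₀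

/-- ★ **DEF-P11's GUARDED `CoP` FACT (the K0 row's displayed [15] content under director-ym №160's F7 edition, binder `0 < M₁`) FROM PROPOSITION 8** at def-R's
support selector: `VariationalThm1RegSepCoP7M` IS `VariationalThm1RegSepTop7M` at `Sup := suppDomOfRecord` (FILE 12d, definitional).
[cite: Balaban1985Variational, Thm 1 (6)–(8) pp.278–279, Prop. 8 p.304] -/
theorem variationalThm1RegSepCoP7M_of_prop8TopStep {B₃ a₀ a₁ : ℝ} (hB : 0 < B₃)
    (h8 : Prop8RegSepTopStep F N (fun ν K Ω => suppDomOfRecord F ν K Ω) B₃ a₀ a₁) :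
    VariationalThm1RegSepCoP7M F N B₃ a₀ a₁ :=
  (variationalThm1RegSepTop7M_of_prop8TopStep (fun ν K Ω => suppDomOfRecord F ν K Ω) hB h8).toCoP7M

end Summit.QuantumFields.YangMills.BalabanUVNodes.N07Thm1Top7FromProp8

end
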